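import Summits.CriticalPhenomena.PercolationContinuityZ3.Theorems.PercNearOneGluingNoHeavyLowerTailSahiThreeCopySliceLaw

/-!
# `NoHeavyLowerTail` (crux stmt-CriticalPhenomena-4575), Sahi programme: **THE POLARIZED THREE-COPY FUNCTIONAL** —
# `6T_b(t₁;t₂;t₃)` with copy `k` carrying its own monotone triple `t_k = (f_k,g_k,h_k)`; the slices of `c_b` ARE polarizations
# (`c_{(1,b)} = 3T(t¹;t⁰;t⁰)`, `c_{(2,b)} = 3T(t⁰;t¹;t¹)`), the slice law (SC) reads `T(t⁰;t¹;t¹) ≥ (2/3)T(t¹;t¹;t¹)`, the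
# partial-lowering identities, the dimension-`0` atom and its positivity on CHAINS, and the conjectured CHAIN LAW
# `T(t₁;t₂;t₃) ≥ 0` for `t₁ ≤ t₂ ≤ t₃` (⟺ a second-order slice law `c_{(1,2,b)} ≥ 3c_b(middle section)` for symmetric data)

Support file (Sahi cell, seat `prim-sahi-p1`, generation 57; `--supports stmt-CriticalPhenomena-4575`); companion of
`…SahiThreeCopySlices` / `…SahiThreeCopySliceLaw`.  Pure identities and inequalities plus one `@[conjecture] def`; no `sorry`,
standard axioms; nothing conjectural is used as a hypothesis-free fact.

THE OBJECT.  The three-copy Sahi coefficient `c_b(f,g,h) = 2N_b(fgh;1;1) − Σ_cyc N_b(f;gh;1) + N_b(f;g;h)` is a cubic functional of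
the triple `t = (f,g,h)`.  Its SYMMETRIC POLARIZATION in the three COPIES is the functional of three triples `t_k = (f_k,g_k,h_k)`
(copy `k` evaluates only the functions of `t_k`):
  `6T_b(t₁;t₂;t₃) = 4 Σ_k N_b(f_kg_kh_k;1;1) − Σ_{i≠j} [N_b(f_i;g_jh_j;1) + N_b(g_i;f_jh_j;1) + N_b(h_i;f_jg_j;1)] + Σ_{π∈S₃} N_b(f_{π1};g_{π2};h_{π3})`
(`tcp6`, all data real).  Equivalently `T_b(t₁;t₂;t₃) = Σ_{(x₁,x₂,x₃) arrangement of b} T₀(t₁(x₁);t₂(x₂);t₃(x₃))` with the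
dimension-0 atom `T₀` (a cubic form on `(ℝ³)³`).
* `tcp6_diag`: `6T(t;t;t) = 6c_b(t)`;  `tcp6_swap12/23`: symmetry in the copies.
* ★ `tc_cons_one_pol`, `tc_cons_two_pol`: **the slices of `c` along a coordinate ARE polarizations**: with sections `t⁰ ≤ t¹`,
  `c_{(1,b)}(F,G,H) = ½·6T_b(t¹;t⁰;t⁰)` and `c_{(2,b)}(F,G,H) = ½·6T_b(t⁰;t¹;t¹)` (so `c₁ = 3T(t¹;t⁰;t⁰)`, `c₂ = 3T(t⁰;t¹;t¹)`; compare
  the sixteen-term forms `tc_cons_one/two` of `…Slices`).  Hence 3C-SAHI in dimension `d+1` ⟺ `T_d ≥ 0` on TWO-LEVEL CHAINS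
  `(t⁰;t⁰;t¹)`, `(t⁰;t¹;t¹)`, and ★ `sliceLaw_iff_pol`: **(SC) ⟺ `2·6T(t¹;t¹;t¹) ≤ 3·6T(t⁰;t¹;t¹)`** — lowering ONE copy from `t¹` to
  any smaller monotone triple keeps at least two thirds of `T`.
* `tcp6_lower_one`: `6T((f⁰,g,h);t;t) = 4c(t) + 2c(f⁰,g,h)` (all real data) — lowering one SLOT of one copy is exactly 3C one
  dimension down; `tcp6_zero_copy`: `6T(0;t;t) = 8N(fgh;1;1) − 2Σ_cyc N(f;gh;1) ≥ 2·[2c(t)]…`, indeed `tcp6_zero_copy_ge`: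
  `6T(0;t;t) ≥ (2/3)·6c(t)` by three-copy Harris — the two extreme cases of (SC) (copy lowered to `0`, resp. not lowered).
* `tcp6_cons_two` (and `_one`): the polarized functional has the CLEAN slice recursion `6T_{(k,b)}(t₁;t₂;t₃) = Σ_{|ε|=k}
  6T_b(t₁^{ε₁};t₂^{ε₂};t₃^{ε₃})` — each copy is sectioned independently.  Consequence `tc_cons_one_two_symm`: for a triple on `d+2`
  coordinates that is SYMMETRIC in `(x₀,x₁)`, with sections `t₁ = t^{00} ≤ t₂ = t^{01} = t^{10} ≤ t₃ = t^{11}`: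
  **`c_{(1,2,b)}(F,G,H) = 6T_b(t₁;t₂;t₃) + 3c_b(t₂)`**.
* ★ `tcp6_dim_zero_eq` / `tcp6_dim_zero_chain_nonneg`: in dimension `0` (the atom), for REAL triples `a ≤ a+δ ≤ a+δ+ε`:
  `6T₀(a;a+δ;a+δ+ε) = per(a,δ,δ) + per(a,δ,ε) + per(a,ε,ε) + ⅓per(δ,δ,δ) + ½per(δ,δ,ε) + (3/2)per(δ,ε,ε) + ⅔per(ε,ε,ε)` with `per` the
  permanent of the 3×3 matrix of slot-values — all coefficients positive, so **`T₀ ≥ 0` on every chain of nonnegative triples**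
  (while `T₀ < 0` on incomparable configurations, e.g. `6T₀((0,1,1);(1,0,1);(1,1,1)) = −1`: this is exactly why linear induction on
  the dimension fails — the sections of a two-level chain contain such `Λ`-configurations).
* `PolarizedChainLaw` (`@[conjecture] def`, OPEN): **`T_b(t₁;t₂;t₃) ≥ 0` for all chains `t₁ ≤ t₂ ≤ t₃` of nonnegative monotone triples**, every
  `d`, every `b`.  Evidence (this generation, kit j335460): dimension 0 (theorem above); for chains of up-set indicator triples, min 0
  over ALL 125 000 chains on `{0,1}^2` × 16 profiles, 15 000 random chains on `{0,1}^3` × 64 profiles, 2 000 on `{0,1}^4` × 256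
  profiles (indicator chains suffice: `T` is trilinear in the three slot-groups `(f₁,f₂,f₃)`, `(g₁,g₂,g₃)`, `(h₁,h₂,h₃)` and a common
  threshold of a chain of monotone functions is a chain of up-sets).  At `t₁ = t₂ = t₃` it is 3C-SAHI (`threeCopySahi_of_chainLaw`), on
  two-level chains it is (by `tc_cons_one/two_pol`) exactly 3C one dimension up, and by `tc_cons_one_two_symm` it is, for
  `(x₀,x₁)`-symmetric triples, the second-order slice law `c_{(1,2,b)} ≥ 3c_b(t^{01})`.  OPEN — an obligation, never a fact.  [this work]
-/

namespace Summit.CriticalPhenomena.PercolationContinuityZ3.Theorems.SahiThreeCopy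

open Finset Function Literature.Combinatorics.Sahi2008
open scoped BigOperators

noncomputable section

variable {d : ℕ}

/-- `N_b(f;0;h) = 0` (local copy; slot symmetry + `N3_zero_left`). [this work] -/
private theorem N3_zero_mid_pol (b : Fin d → ℕ) (f h : Pt d → ℝ) : N3 b f 0 h = 0 := by rw [N3_comm12, N3_zero_left]

/-- `N_b(f;g;0) = 0` (local copy). [this work] -/
private theorem N3_zero_right_pol (b : Fin d → ℕ) (f g : Pt d → ℝ) : N3 b f g 0 = 0 := by rw [N3_comm13, N3_zero_left]

/-- In dimension `0`, `N_b(f;g;h)` is the product of the three values at any (the) point. [this work] -/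
private theorem N3_at (b : Fin 0 → ℕ) (p : Pt 0) (f g h : Pt 0 → ℝ) : N3 b f g h = f p * g p * h p := by
  obtain rfl : p = fun i => Fin.elim0 i := Subsingleton.elim _ _
  exact N3_dim_zero b f g h

/-! ### §1 The polarized functional -/

/-- `6T_b(t₁;t₂;t₃)`: six times the symmetric polarization of the three-copy Sahi coefficient in the three copies; copy `k`
carries the triple `(f_k,g_k,h_k)` (arguments in the order `f₁ g₁ h₁ f₂ g₂ h₂ f₃ g₃ h₃`). [this work] -/
def tcp6 (b : Fin d → ℕ) (f₁ g₁ h₁ f₂ g₂ h₂ f₃ g₃ h₃ : Pt d → ℝ) : ℝ :=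
  4 * (N3 b (f₁ * g₁ * h₁) 1 1 + N3 b (f₂ * g₂ * h₂) 1 1 + N3 b (f₃ * g₃ * h₃) 1 1)
  - (N3 b f₁ (g₂ * h₂) 1 + N3 b g₁ (f₂ * h₂) 1 + N3 b h₁ (f₂ * g₂) 1
      + N3 b f₁ (g₃ * h₃) 1 + N3 b g₁ (f₃ * h₃) 1 + N3 b h₁ (f₃ * g₃) 1
      + N3 b f₂ (g₁ * h₁) 1 + N3 b g₂ (f₁ * h₁) 1 + N3 b h₂ (f₁ * g₁) 1
      + N3 b f₂ (g₃ * h₃) 1 + N3 b g₂ (f₃ * h₃) 1 + N3 b h₂ (f₃ * g₃) 1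
      + N3 b f₃ (g₁ * h₁) 1 + N3 b g₃ (f₁ * h₁) 1 + N3 b h₃ (f₁ * g₁) 1
      + N3 b f₃ (g₂ * h₂) 1 + N3 b g₃ (f₂ * h₂) 1 + N3 b h₃ (f₂ * g₂) 1)
  + (N3 b f₁ g₂ h₃ + N3 b f₁ g₃ h₂ + N3 b f₂ g₁ h₃ + N3 b f₂ g₃ h₁ + N3 b f₃ g₁ h₂ + N3 b f₃ g₂ h₁)

/-- On the diagonal the polarization is `6c_b`. [this work] -/
theorem tcp6_diag (b : Fin d → ℕ) (f g h : Pt d → ℝ) : tcp6 b f g h f g h f g h = 6 * tc b f g h := by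
  unfold tcp6 tc; ring

/-- Symmetry in copies 1 and 2. [this work] -/
theorem tcp6_swap12 (b : Fin d → ℕ) (f₁ g₁ h₁ f₂ g₂ h₂ f₃ g₃ h₃ : Pt d → ℝ) :
    tcp6 b f₁ g₁ h₁ f₂ g₂ h₂ f₃ g₃ h₃ = tcp6 b f₂ g₂ h₂ f₁ g₁ h₁ f₃ g₃ h₃ := by
  unfold tcp6; ring

/-- Symmetry in copies 2 and 3. [this work] -/
theorem tcp6_swap23 (b : Fin d → ℕ) (f₁ g₁ h₁ f₂ g₂ h₂ f₃ g₃ h₃ : Pt d → ℝ) :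
    tcp6 b f₁ g₁ h₁ f₂ g₂ h₂ f₃ g₃ h₃ = tcp6 b f₁ g₁ h₁ f₃ g₃ h₃ f₂ g₂ h₂ := by
  unfold tcp6; ring

/-- Symmetry in copies 1 and 3. [this work] -/
theorem tcp6_swap13 (b : Fin d → ℕ) (f₁ g₁ h₁ f₂ g₂ h₂ f₃ g₃ h₃ : Pt d → ℝ) :
    tcp6 b f₁ g₁ h₁ f₂ g₂ h₂ f₃ g₃ h₃ = tcp6 b f₃ g₃ h₃ f₂ g₂ h₂ f₁ g₁ h₁ := by
  unfold tcp6; ring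

/-! ### §2 The slices of `c_b` are polarizations -/

/-- ★ **`c_{(2,b)}(F,G,H) = ½·6T_b(t⁰;t¹;t¹)`**: the profile-2 slice along coordinate `0` is (three times) the polarization with
ONE copy at the bottom sections and two at the top (all data real). [this work] -/
theorem tc_cons_two_pol (b : Fin d → ℕ) (F G H : Pt (d + 1) → ℝ) :
    tc (Fin.cons 2 b : Fin (d + 1) → ℕ) F G H =
      (1 / 2 : ℝ) * tcp6 b (sec F false) (sec G false) (sec H false) (sec F true) (sec G true) (sec H true)
        (sec F true) (sec G true) (sec H true) := by
  unfold tc tcp6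
  simp only [N3_cons_two, sec_mul, sec_one]
  ring

/-- ★ **`c_{(1,b)}(F,G,H) = ½·6T_b(t¹;t⁰;t⁰)`**: the profile-1 slice is the polarization with one copy at the top sections and two at
the bottom. [this work] -/
theorem tc_cons_one_pol (b : Fin d → ℕ) (F G H : Pt (d + 1) → ℝ) :
    tc (Fin.cons 1 b : Fin (d + 1) → ℕ) F G H =
      (1 / 2 : ℝ) * tcp6 b (sec F true) (sec G true) (sec H true) (sec F false) (sec G false) (sec H false)
        (sec F false) (sec G false) (sec H false) := by
  unfold tc tcp6
  simp only [N3_cons_one, sec_mul, sec_one]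
  ring

/-- ★ **(SC) in polarized form**: the slice law `2c_b(F¹,G¹,H¹) ≤ c_{(2,b)}(F,G,H)` says exactly
`2·6T_b(t¹;t¹;t¹) ≤ 3·6T_b(t⁰;t¹;t¹)` — lowering one copy to the bottom sections keeps two thirds of `T`. [this work] -/
theorem sliceLaw_iff_pol : SliceLaw ↔
    ∀ (d : ℕ) (b : Fin d → ℕ) (F G H : Pt (d + 1) → ℝ), (∀ x, 0 ≤ F x) → (∀ x, 0 ≤ G x) → (∀ x, 0 ≤ H x) →
      Monotone F → Monotone G → Monotone H →
        2 * tcp6 b (sec F true) (sec G true) (sec H true) (sec F true) (sec G true) (sec H true) (sec F true) (sec G true) (sec H true)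
          ≤ 3 * tcp6 b (sec F false) (sec G false) (sec H false) (sec F true) (sec G true) (sec H true)
              (sec F true) (sec G true) (sec H true) := by
  unfold SliceLaw
  refine forall_congr' fun d => forall_congr' fun b => forall_congr' fun F => forall_congr' fun G => forall_congr' fun H => ?_
  refine forall_congr' fun _ => forall_congr' fun _ => forall_congr' fun _ => forall_congr' fun _ => forall_congr' fun _ =>
    forall_congr' fun _ => ?_
  rw [tc_cons_two_pol, tcp6_diag]
  constructor <;> intro h <;> linarith

/-! ### §3 Partial lowering -/

/-- **Lowering one slot of one copy**: `6T_b((f⁰,g,h);t;t) = 4c_b(f,g,h) + 2c_b(f⁰,g,h)` for ALL real data — with `tc_cons_two_pol`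
this is the statement that (SC) for a triple whose second and third slots do not depend on the sliced coordinate is 3C-SAHI one
dimension down. [this work] -/
theorem tcp6_lower_one (b : Fin d → ℕ) (f₀ f g h : Pt d → ℝ) :
    tcp6 b f₀ g h f g h f g h = 4 * tc b f g h + 2 * tc b f₀ g h := by
  unfold tcp6 tc; ring

/-- **Lowering a whole copy to zero**: `6T_b(0;t;t) = 8N_b(fgh;1;1) − 2Σ_cyc N_b(f;gh;1)`. [this work] -/
theorem tcp6_zero_copy (b : Fin d → ℕ) (f g h : Pt d → ℝ) :
    tcp6 b 0 0 0 f g h f g h = 8 * N3 b (f * g * h) 1 1 - 2 * (N3 b f (g * h) 1 + N3 b g (f * h) 1 + N3 b h (f * g) 1) := by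
  unfold tcp6
  simp only [mul_zero, N3_zero_left, N3_zero_mid_pol, N3_zero_right_pol]
  ring

/-- Hence `6T_b(0;t;t) ≥ ⅔·6c_b(t)`, i.e. `4N(fgh;1;1) − ΣN(f;gh;1) ≥ 2c_b(f,g,h)`, for nonnegative monotone `f,g,h`: the case "one
copy lowered all the way to `0`" of (SC) is three-copy Harris (`N(f;g;h) ≤ N(f;gh;1)` three times). [this work] -/
theorem tcp6_zero_copy_ge (b : Fin d → ℕ) {f g h : Pt d → ℝ} (hf : ∀ x, 0 ≤ f x) (hg : ∀ x, 0 ≤ g x) (hh : ∀ x, 0 ≤ h x)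
    (hfm : Monotone f) (hgm : Monotone g) (hhm : Monotone h) :
    2 * (6 * tc b f g h) ≤ 3 * tcp6 b 0 0 0 f g h f g h := by
  rw [tcp6_zero_copy]
  unfold tc
  -- three-copy Harris three times: `N_b(f;g;h) ≤ N_b(f;gh;1)`, `≤ N_b(g;fh;1)`, `≤ N_b(h;fg;1)`, and `N_b(f;g;h) ≥ 0`
  have h0 : 0 ≤ N3 b f g h := N3_nonneg b hf hg hh
  have h1 : N3 b f g h ≤ N3 b f (g * h) 1 := by
    have e1 : N3 b f g h = N3 b g h f := by rw [N3_comm12, N3_comm23]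
    have e2 : N3 b f (g * h) 1 = N3 b (g * h) 1 f := by rw [N3_comm12, N3_comm23]
    rw [e1, e2]; exact N3_le_N3_mul d b g h f hg hgm hh hhm hf
  have h2 : N3 b f g h ≤ N3 b g (f * h) 1 := by
    have e1 : N3 b f g h = N3 b f h g := N3_comm23 b f g h
    have e2 : N3 b g (f * h) 1 = N3 b (f * h) 1 g := by rw [N3_comm12, N3_comm23]
    rw [e1, e2]; exact N3_le_N3_mul d b f h g hf hfm hh hhm hg
  have h3 : N3 b f g h ≤ N3 b h (f * g) 1 := by
    have e2 : N3 b h (f * g) 1 = N3 b (f * g) 1 h := by rw [N3_comm12, N3_comm23]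
    rw [e2]; exact N3_le_N3_mul d b f g h hf hfm hg hgm hh
  linarith [h0, h1, h2, h3]

/-! ### §4 The slice recursion of the polarized functional and the symmetric second-order slice -/

/-- The polarized functional sections COPY BY COPY: `6T_{(2,b)}(t₁;t₂;t₃) = Σ_{|ε|=2} 6T_b(t₁^{ε₁};t₂^{ε₂};t₃^{ε₃})` (all data real;
arguments: the nine functions on the `(d+1)`-cube). [this work] -/
theorem tcp6_cons_two (b : Fin d → ℕ) (f₁ g₁ h₁ f₂ g₂ h₂ f₃ g₃ h₃ : Pt (d + 1) → ℝ) :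
    tcp6 (Fin.cons 2 b : Fin (d + 1) → ℕ) f₁ g₁ h₁ f₂ g₂ h₂ f₃ g₃ h₃ =
      tcp6 b (sec f₁ false) (sec g₁ false) (sec h₁ false) (sec f₂ true) (sec g₂ true) (sec h₂ true)
          (sec f₃ true) (sec g₃ true) (sec h₃ true)
      + tcp6 b (sec f₁ true) (sec g₁ true) (sec h₁ true) (sec f₂ false) (sec g₂ false) (sec h₂ false)
          (sec f₃ true) (sec g₃ true) (sec h₃ true)
      + tcp6 b (sec f₁ true) (sec g₁ true) (sec h₁ true) (sec f₂ true) (sec g₂ true) (sec h₂ true)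
          (sec f₃ false) (sec g₃ false) (sec h₃ false) := by
  unfold tcp6
  simp only [N3_cons_two, sec_mul, sec_one]
  ring

/-- Profile-1 companion: `6T_{(1,b)}(t₁;t₂;t₃) = Σ_{|ε|=1} 6T_b(t₁^{ε₁};t₂^{ε₂};t₃^{ε₃})`. [this work] -/
theorem tcp6_cons_one (b : Fin d → ℕ) (f₁ g₁ h₁ f₂ g₂ h₂ f₃ g₃ h₃ : Pt (d + 1) → ℝ) :
    tcp6 (Fin.cons 1 b : Fin (d + 1) → ℕ) f₁ g₁ h₁ f₂ g₂ h₂ f₃ g₃ h₃ =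
      tcp6 b (sec f₁ true) (sec g₁ true) (sec h₁ true) (sec f₂ false) (sec g₂ false) (sec h₂ false)
          (sec f₃ false) (sec g₃ false) (sec h₃ false)
      + tcp6 b (sec f₁ false) (sec g₁ false) (sec h₁ false) (sec f₂ true) (sec g₂ true) (sec h₂ true)
          (sec f₃ false) (sec g₃ false) (sec h₃ false)
      + tcp6 b (sec f₁ false) (sec g₁ false) (sec h₁ false) (sec f₂ false) (sec g₂ false) (sec h₂ false)
          (sec f₃ true) (sec g₃ true) (sec h₃ true) := by
  unfold tcp6
  simp only [N3_cons_one, sec_mul, sec_one]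
  ring

/-- Iterated sections along the first two coordinates: `u^{a,c}(x) = u(a, c, x)`. [this work] -/
def sec2 (u : Pt (d + 2) → ℝ) (a c : Bool) : Pt d → ℝ := sec (sec u a) c

/-- ★ **The symmetric second-order slice.**  For a triple on `d+2` coordinates that is SYMMETRIC in its first two coordinates
(`u^{01} = u^{10}` for `u = F, G, H`), with `t₁ = t^{00}`, `t₂ = t^{01}`, `t₃ = t^{11}`:
`c_{(1,2,b)}(F,G,H) = 6T_b(t₁;t₂;t₃) + 3c_b(t₂)` (all data real).  So the conjectured chain law is, for such data, the second-order
slice law `c_{(1,2,b)} ≥ 3c_b(F^{01},G^{01},H^{01})`. [this work] -/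
theorem tc_cons_one_two_symm (b : Fin d → ℕ) (F G H : Pt (d + 2) → ℝ) (hF : sec2 F false true = sec2 F true false)
    (hG : sec2 G false true = sec2 G true false) (hH : sec2 H false true = sec2 H true false) :
    tc (Fin.cons 1 (Fin.cons 2 b) : Fin (d + 2) → ℕ) F G H =
      tcp6 b (sec2 F false false) (sec2 G false false) (sec2 H false false) (sec2 F false true) (sec2 G false true)
          (sec2 H false true) (sec2 F true true) (sec2 G true true) (sec2 H true true)
        + 3 * tc b (sec2 F false true) (sec2 G false true) (sec2 H false true) := by
  rw [tc_cons_one_pol, tcp6_cons_two]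
  unfold sec2 at hF hG hH ⊢
  rw [← hF, ← hG, ← hH]
  unfold tcp6 tc
  ring

/-! ### §5 The dimension-0 atom and its positivity on chains -/

/-- The atom: in dimension `0` every `N_b` is the product of the three values at the point `p`, so `6T₀` is an explicit cubic
form in the nine values. [this work] -/
theorem tcp6_dim_zero (b : Fin 0 → ℕ) (p : Pt 0) (f₁ g₁ h₁ f₂ g₂ h₂ f₃ g₃ h₃ : Pt 0 → ℝ) :
    tcp6 b f₁ g₁ h₁ f₂ g₂ h₂ f₃ g₃ h₃ =
      4 * (f₁ p * g₁ p * h₁ p + f₂ p * g₂ p * h₂ p + f₃ p * g₃ p * h₃ p)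
      - (f₁ p * (g₂ p * h₂ p) + g₁ p * (f₂ p * h₂ p) + h₁ p * (f₂ p * g₂ p)
          + f₁ p * (g₃ p * h₃ p) + g₁ p * (f₃ p * h₃ p) + h₁ p * (f₃ p * g₃ p)
          + f₂ p * (g₁ p * h₁ p) + g₂ p * (f₁ p * h₁ p) + h₂ p * (f₁ p * g₁ p)
          + f₂ p * (g₃ p * h₃ p) + g₂ p * (f₃ p * h₃ p) + h₂ p * (f₃ p * g₃ p)
          + f₃ p * (g₁ p * h₁ p) + g₃ p * (f₁ p * h₁ p) + h₃ p * (f₁ p * g₁ p)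
          + f₃ p * (g₂ p * h₂ p) + g₃ p * (f₂ p * h₂ p) + h₃ p * (f₂ p * g₂ p))
      + (f₁ p * g₂ p * h₃ p + f₁ p * g₃ p * h₂ p + f₂ p * g₁ p * h₃ p + f₂ p * g₃ p * h₁ p
          + f₃ p * g₁ p * h₂ p + f₃ p * g₂ p * h₁ p) := by
  unfold tcp6
  simp only [N3_at b p, Pi.mul_apply, Pi.one_apply, mul_one]

/-- ★ **The atom is nonnegative on chains.**  In dimension `0`, for real triples `t₁ ≤ t₂ ≤ t₃` (componentwise) with `t₁ ≥ 0`: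
`6T₀(t₁;t₂;t₃) ≥ 0`.  Proof: with `a = t₁`, `δ = t₂ − t₁`, `ε = t₃ − t₂` one has the POSITIVE expansion
`6T₀ = per(a,δ,δ) + per(a,δ,ε) + per(a,ε,ε) + ⅓per(δ,δ,δ) + ½per(δ,δ,ε) + (3/2)per(δ,ε,ε) + ⅔per(ε,ε,ε)` (`per` = permanent of the
3×3 matrix whose rows are the three slot-vectors).  By contrast `6T₀((0,1,1);(1,0,1);(1,1,1)) = −1`: the atom is negative on
incomparable ("Λ") configurations, which is what the sections of a two-level chain produce. [this work] -/
theorem tcp6_dim_zero_chain_nonneg (b : Fin 0 → ℕ) {f₁ g₁ h₁ f₂ g₂ h₂ f₃ g₃ h₃ : Pt 0 → ℝ}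
    (hf₁ : ∀ x, 0 ≤ f₁ x) (hg₁ : ∀ x, 0 ≤ g₁ x) (hh₁ : ∀ x, 0 ≤ h₁ x)
    (hf₁₂ : ∀ x, f₁ x ≤ f₂ x) (hg₁₂ : ∀ x, g₁ x ≤ g₂ x) (hh₁₂ : ∀ x, h₁ x ≤ h₂ x)
    (hf₂₃ : ∀ x, f₂ x ≤ f₃ x) (hg₂₃ : ∀ x, g₂ x ≤ g₃ x) (hh₂₃ : ∀ x, h₂ x ≤ h₃ x) :
    0 ≤ tcp6 b f₁ g₁ h₁ f₂ g₂ h₂ f₃ g₃ h₃ := by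
  set p : Pt 0 := fun i => Fin.elim0 i
  rw [tcp6_dim_zero b p]
  -- increments
  have ha := hf₁ p; have hb := hg₁ p; have hc := hh₁ p
  have hd1 : 0 ≤ f₂ p - f₁ p := sub_nonneg.2 (hf₁₂ p)
  have hd2 : 0 ≤ g₂ p - g₁ p := sub_nonneg.2 (hg₁₂ p)
  have hd3 : 0 ≤ h₂ p - h₁ p := sub_nonneg.2 (hh₁₂ p)
  have he1 : 0 ≤ f₃ p - f₂ p := sub_nonneg.2 (hf₂₃ p)
  have he2 : 0 ≤ g₃ p - g₂ p := sub_nonneg.2 (hg₂₃ p)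
  have he3 : 0 ≤ h₃ p - h₂ p := sub_nonneg.2 (hh₂₃ p)
  -- the positive expansion (verified by `ring`): 6T₀ = Σ (positive coefficient) × (product of three of a,δ,ε in distinct slots)
  have key : (4 * (f₁ p * g₁ p * h₁ p + f₂ p * g₂ p * h₂ p + f₃ p * g₃ p * h₃ p)
      - (f₁ p * (g₂ p * h₂ p) + g₁ p * (f₂ p * h₂ p) + h₁ p * (f₂ p * g₂ p)
          + f₁ p * (g₃ p * h₃ p) + g₁ p * (f₃ p * h₃ p) + h₁ p * (f₃ p * g₃ p)
          + f₂ p * (g₁ p * h₁ p) + g₂ p * (f₁ p * h₁ p) + h₂ p * (f₁ p * g₁ p)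
          + f₂ p * (g₃ p * h₃ p) + g₂ p * (f₃ p * h₃ p) + h₂ p * (f₃ p * g₃ p)
          + f₃ p * (g₁ p * h₁ p) + g₃ p * (f₁ p * h₁ p) + h₃ p * (f₁ p * g₁ p)
          + f₃ p * (g₂ p * h₂ p) + g₃ p * (f₂ p * h₂ p) + h₃ p * (f₂ p * g₂ p))
      + (f₁ p * g₂ p * h₃ p + f₁ p * g₃ p * h₂ p + f₂ p * g₁ p * h₃ p + f₂ p * g₃ p * h₁ p
          + f₃ p * g₁ p * h₂ p + f₃ p * g₂ p * h₁ p))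
      = 2 * (f₁ p * (g₂ p - g₁ p) * (h₂ p - h₁ p) + (f₂ p - f₁ p) * g₁ p * (h₂ p - h₁ p)
              + (f₂ p - f₁ p) * (g₂ p - g₁ p) * h₁ p)
        + (f₁ p * (g₂ p - g₁ p) * (h₃ p - h₂ p) + f₁ p * (g₃ p - g₂ p) * (h₂ p - h₁ p)
            + (f₂ p - f₁ p) * g₁ p * (h₃ p - h₂ p) + (f₃ p - f₂ p) * g₁ p * (h₂ p - h₁ p)
            + (f₂ p - f₁ p) * (g₃ p - g₂ p) * h₁ p + (f₃ p - f₂ p) * (g₂ p - g₁ p) * h₁ p)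
        + 2 * (f₁ p * (g₃ p - g₂ p) * (h₃ p - h₂ p) + (f₃ p - f₂ p) * g₁ p * (h₃ p - h₂ p)
              + (f₃ p - f₂ p) * (g₃ p - g₂ p) * h₁ p)
        + 2 * ((f₂ p - f₁ p) * (g₂ p - g₁ p) * (h₂ p - h₁ p))
        + ((f₂ p - f₁ p) * (g₂ p - g₁ p) * (h₃ p - h₂ p) + (f₂ p - f₁ p) * (g₃ p - g₂ p) * (h₂ p - h₁ p)
            + (f₃ p - f₂ p) * (g₂ p - g₁ p) * (h₂ p - h₁ p))
        + 3 * ((f₂ p - f₁ p) * (g₃ p - g₂ p) * (h₃ p - h₂ p) + (f₃ p - f₂ p) * (g₂ p - g₁ p) * (h₃ p - h₂ p)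
              + (f₃ p - f₂ p) * (g₃ p - g₂ p) * (h₂ p - h₁ p))
        + 4 * ((f₃ p - f₂ p) * (g₃ p - g₂ p) * (h₃ p - h₂ p)) := by
    ring
  rw [key]
  have m3 : ∀ {x y z : ℝ}, 0 ≤ x → 0 ≤ y → 0 ≤ z → 0 ≤ x * y * z := fun hx hy hz => mul_nonneg (mul_nonneg hx hy) hz
  have t1 := m3 ha hd2 hd3; have t2 := m3 hd1 hb hd3; have t3 := m3 hd1 hd2 hc
  have t4 := m3 ha hd2 he3; have t5 := m3 ha he2 hd3; have t6 := m3 hd1 hb he3; have t7 := m3 he1 hb hd3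
  have t8 := m3 hd1 he2 hc; have t9 := m3 he1 hd2 hc
  have t10 := m3 ha he2 he3; have t11 := m3 he1 hb he3; have t12 := m3 he1 he2 hc
  have t13 := m3 hd1 hd2 hd3
  have t14 := m3 hd1 hd2 he3; have t15 := m3 hd1 he2 hd3; have t16 := m3 he1 hd2 hd3
  have t17 := m3 hd1 he2 he3; have t18 := m3 he1 hd2 he3; have t19 := m3 he1 he2 hd3
  have t20 := m3 he1 he2 he3
  linarith

/-! ### §6 The chain law — an OBLIGATION, never a fact -/

/-- **THE CHAIN LAW** (conjecture of this generation; OPEN): for every dimension `d`, profile `b` and every CHAIN `t₁ ≤ t₂ ≤ t₃` of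
nonnegative monotone triples on `{0,1}^d` (componentwise: `f₁ ≤ f₂ ≤ f₃`, `g₁ ≤ g₂ ≤ g₃`, `h₁ ≤ h₂ ≤ h₃`), the polarized three-copy
Sahi functional is nonnegative: `6T_b(t₁;t₂;t₃) ≥ 0`.  At `t₁ = t₂ = t₃` this is 3C-SAHI (`threeCopySahi_of_chainLaw`); on two-level
chains it is 3C-SAHI one dimension up (`tc_cons_one/two_pol`); for three levels it is NEW and by `tc_cons_one_two_symm` equivalent to
the second-order slice law `c_{(1,2,b)}(F,G,H) ≥ 3c_b(F^{01},G^{01},H^{01})` for `(x₀,x₁)`-symmetric triples.  Evidence: dimension 0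
(`tcp6_dim_zero_chain_nonneg`); up-set chains: exhaustive on `{0,1}^d`, `d ≤ 2` (all profiles), 15 000 / 2 000 random chains at `d = 3 / 4`
(all profiles), minimum exactly 0 (kit j335460, this seat); indicators suffice by trilinearity in the slot-groups and common thresholds.
OPEN — an obligation / hypothesis, never a fact; a proof would be `PolarizedChainLaw_holds`. [this work] [status: open] -/
@[conjecture] def PolarizedChainLaw : Prop :=
  ∀ (d : ℕ) (b : Fin d → ℕ) (f₁ g₁ h₁ f₂ g₂ h₂ f₃ g₃ h₃ : Pt d → ℝ),
    (∀ x, 0 ≤ f₁ x) → (∀ x, 0 ≤ g₁ x) → (∀ x, 0 ≤ h₁ x) →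
    Monotone f₁ → Monotone g₁ → Monotone h₁ → Monotone f₂ → Monotone g₂ → Monotone h₂ →
    Monotone f₃ → Monotone g₃ → Monotone h₃ →
    (∀ x, f₁ x ≤ f₂ x) → (∀ x, g₁ x ≤ g₂ x) → (∀ x, h₁ x ≤ h₂ x) →
    (∀ x, f₂ x ≤ f₃ x) → (∀ x, g₂ x ≤ g₃ x) → (∀ x, h₂ x ≤ h₃ x) →
      0 ≤ tcp6 b f₁ g₁ h₁ f₂ g₂ h₂ f₃ g₃ h₃

/-- The chain law contains 3C-SAHI (the constant chain). [this work] -/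
theorem threeCopySahi_of_chainLaw (hCL : PolarizedChainLaw) : ThreeCopySahi := by
  intro d b f g h hf hg hh hfm hgm hhm
  have h6 := hCL d b f g h f g h f g h hf hg hh hfm hgm hhm hfm hgm hhm hfm hgm hhm (fun _ => le_rfl) (fun _ => le_rfl)
    (fun _ => le_rfl) (fun _ => le_rfl) (fun _ => le_rfl) (fun _ => le_rfl)
  rw [tcp6_diag] at h6
  linarith

/-- The chain law implies the slice law (SC)?  No such implication is claimed; but the chain law at the two-level chain `(t⁰;t¹;t¹)`
IS `c_{(2,b)} ≥ 0`, i.e. it re-proves the profile-2 half of 3C-SAHI one dimension up directly (recorded as a consistency check of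
`tc_cons_two_pol`). [this work] -/
theorem tc_cons_two_nonneg_of_chainLaw (hCL : PolarizedChainLaw) (b : Fin d → ℕ) {F G H : Pt (d + 1) → ℝ} (hF : ∀ x, 0 ≤ F x)
    (hG : ∀ x, 0 ≤ G x) (hH : ∀ x, 0 ≤ H x) (hFm : Monotone F) (hGm : Monotone G) (hHm : Monotone H) :
    0 ≤ tc (Fin.cons 2 b : Fin (d + 1) → ℕ) F G H := by
  rw [tc_cons_two_pol]
  have h6 := hCL d b (sec F false) (sec G false) (sec H false) (sec F true) (sec G true) (sec H true) (sec F true) (sec G true)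
    (sec H true) (sec_nonneg hF false) (sec_nonneg hG false) (sec_nonneg hH false) (sec_monotone hFm false) (sec_monotone hGm false)
    (sec_monotone hHm false) (sec_monotone hFm true) (sec_monotone hGm true) (sec_monotone hHm true) (sec_monotone hFm true)
    (sec_monotone hGm true) (sec_monotone hHm true) (sec_false_le_sec_true hFm) (sec_false_le_sec_true hGm)
    (sec_false_le_sec_true hHm) (fun _ => le_rfl) (fun _ => le_rfl) (fun _ => le_rfl)
  linarith

end

end Summit.CriticalPhenomena.PercolationContinuityZ3.Theorems.SahiThreeCopy
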